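import Literature.MathematicalPhysics.QuantumLattice.FermionEmbedding
import HarnessLib

/-!
# The frozen-environment embedding of Fock spaces along an order embedding of orbitals

Topic `Literature/MathematicalPhysics/QuantumLattice`; the STATE-level companion of `FermionEmbedding.lean`
(the algebra homomorphism `jwEmbed e : 𝔄(ι) → 𝔄(ι')`, `c_i ↦ c_{e i}`, of an order embedding
`e : ι ↪o ι'` of finite linearly ordered orbital sets). The Fock space over `ι'` factorises as
`𝔉(ι') ≅ 𝔉(e ι) ⊗ 𝔉(ι' ∖ e ι)` (Bratteli–Robinson II §5.2.1–5.2.2; in the occupation-number basis a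
configuration `u' ⊆ ι'` is the pair (image part `pre e u'`, environment part `env e u'`)), and for
every FIXED environment configuration `K ⊆ ι' ∖ e ι` the vectors supported on `{u' : env e u' = K}`
form a copy of `𝔉(ι)`: the states `ψ ⊗ |K⟩` (the environment orbitals of `K` occupied, the other
environment orbitals empty). In quantum chemistry this is the structure of every FROZEN-CORE /
ACTIVE-SPACE wave function `|Φ_core Φ_active⟩` (Helgaker–Jørgensen–Olsen (2000) §12.5; Koridon et
al. (2021) App. A eq. (A1)), the core orbitals doubly occupied and the deleted virtual orbitals empty.

## Contents (all PROVED, 0 sorry; one definition)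

* `frozenEmbed e K : Matrix (Finset ι') (Finset ι) ℂ` — the isometry `V_K : 𝔉(ι) → 𝔉(ι')`,
  `(V_K ψ)(u') = [env e u' = K] · transSign e K (pre e u') · ψ (pre e u')` (`frozenEmbed_mulVec_apply`;
  the Jordan–Wigner sign `transSign` of `FermionEmbedding.lean` is what makes `V_K` a module map for
  `jwEmbed e`; it is `1` in the spinful orbital-major setting of quantum chemistry);
  `conjTranspose_frozenEmbed_mul_self` (`V_Kᴴ V_K = 1`), `isNParticle_frozenEmbed_mulVec` (`N ↦ N + |K|`);
* **`jwEmbed_mul_frozenEmbed`**: `jwEmbed e a · V_K = V_K · a`, hence `V_Kᴴ (jwEmbed e a) V_K = a`;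
* the environment letters on the frozen block: `n_k V_K = V_K` and `c†_k V_K = 0` (`k ∈ K`),
  `c_m V_K = 0` (`m` an environment orbital outside `K`), `c†_k c_m V_K = 0` (`k ∈ K`, `m ≠ k`);
  `[jwEmbed e a, n_m] = 0` for every environment orbital `m`;
* the COMPRESSION RULES that reduce a Hamiltonian of the big space to the frozen block: for an
  environment orbital `m` and any `X` commuting with `n_m`, `V_Kᴴ (X c_m) V_K = 0 = V_Kᴴ (c†_m X) V_K`
  (`sandwich_annihilation_eq_zero`, `sandwich_creation_eq_zero`) and
  `V_Kᴴ (X c†_k c_m) V_K = [k = m ∈ K] · V_Kᴴ X V_K` (`sandwich_creation_mul_annihilation`).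

NOT here: the action of `c_k`, `k ∈ K` (it maps the `K`-block onto the `K ∖ {k}`-block), environment
states other than occupation-basis vectors, anything spinful (the frozen-core reduction of the
molecular Hamiltonian built on this file is `QuantumChemistry/FrozenCoreHamiltonian.lean`).
Tree search: `lean search 'frozenEmbed|frozen|coreEmbed'` — no state-level embedding in the tree
(`jwEmbed`, `fermionEmbed` are the algebra maps; `fockRelabel` the bijection case); REUSED:
`JWEmbed.*`, `embedFun_apply`, `transSign_mul_transSign` (`FermionEmbedding`), `annihilation_apply`,
`creation_apply`, `numberAt_eq_diagonal`, `number_mul_creation_of_ne`, `creation_mul_self`,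
`annihilation_mul_creation` (`FermionOperators(Proofs)`).

## References

* O. Bratteli, D. W. Robinson, *Operator Algebras and Quantum Statistical Mechanics 2*, 2nd ed.
  (Springer 1997), §5.2.1 (Fock space; `𝔉(𝔥₁ ⊕ 𝔥₂)`), §5.2.2 Thm. 5.2.5 / eq. (5.2.13) (the
  Jordan–Wigner = Fock representation and the isotony of the local CAR algebras). [BratteliRobinsonII1997]
* T. Helgaker, P. Jørgensen, J. Olsen, *Molecular Electronic-Structure Theory* (Wiley 2000), §12.5.1
  eqs. (12.5.12), (12.5.16) (inactive orbitals, inactive Fock matrix and inactive energy). [HelgakerJorgensenOlsen2000]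
* E. Koridon, S. Yalouz, B. Senjean, F. Buda, T. E. O'Brien, L. Visscher, Phys. Rev. Research 3 (2021)
  033127, Appendix A "Frozen core Hamiltonian", eqs. (A1)–(A6). [KoridonEtAl2021]
-/

noncomputable section

namespace Literature.MathematicalPhysics.QuantumLattice

open Matrix Finset JWEmbed
open scoped symmDiff

section Def

variable {ι ι' : Type*} [LinearOrder ι] [LinearOrder ι'] [Fintype ι]

/-- The **frozen-environment embedding** `V_K : 𝔉(ι) → 𝔉(ι')` along the order embedding
`e : ι ↪o ι'` with the environment configuration frozen to `K` (a finite set of orbitals of `ι'`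
outside the image of `e`): the rectangular matrix with entries
`(V_K)_{u', u} = [env e u' = K ∧ pre e u' = u] · transSign e K u`, i.e. `V_K |u⟩ = ± |e u ∪ K⟩` with
the Jordan–Wigner sign that makes `V_K` intertwine `jwEmbed e`. If `K` meets the image of `e` no
configuration has environment `K` and `V_K = 0` (all results assume `Disjoint K (rangeF e)`).
The frozen-core / deleted-virtual wave functions `|Φ_core Φ_active⟩` of quantum chemistry are the
vectors `V_K ψ` with `K` = the core spin orbitals. Bratteli–Robinson II §5.2.1 (`𝔉(𝔥₁ ⊕ 𝔥₂)`);
Koridon et al. (2021) App. A eq. (A1). [cite: BratteliRobinsonII1997, §5.2.1-5.2.2 (Fock space of a direct sum; Thm. 5.2.5)] -/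
def frozenEmbed (e : ι ↪o ι') (K : Finset ι') : Matrix (Finset ι') (Finset ι) ℂ :=
  fun u' u => if env e u' = K ∧ pre e u' = u then transSign e K u else 0

variable (e : ι ↪o ι') (K : Finset ι')

/-- The entries of `V_K` (definitional). [cite: BratteliRobinsonII1997, §5.2.1 (Fock space 𝔉(𝔥₁ ⊕ 𝔥₂); occupation-number basis)] -/
theorem frozenEmbed_apply (u' : Finset ι') (u : Finset ι) :
    frozenEmbed e K u' u = if env e u' = K ∧ pre e u' = u then transSign e K u else 0 := rfl

/-- Rows of `V_K` outside the `K`-block vanish. [cite: BratteliRobinsonII1997, §5.2.1 (Fock space 𝔉(𝔥₁ ⊕ 𝔥₂); occupation-number basis)] -/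
theorem frozenEmbed_apply_of_env_ne {u' : Finset ι'} (h : env e u' ≠ K) (u : Finset ι) :
    frozenEmbed e K u' u = 0 := by
  rw [frozenEmbed_apply, if_neg (fun h' => h h'.1)]

/-- A non-zero entry of `V_K` sits in the `K`-block, in the column of the image part. [cite: BratteliRobinsonII1997, §5.2.1 (Fock space 𝔉(𝔥₁ ⊕ 𝔥₂); occupation-number basis)] -/
theorem env_eq_of_frozenEmbed_ne_zero {u' : Finset ι'} {u : Finset ι} (h : frozenEmbed e K u' u ≠ 0) :
    env e u' = K ∧ pre e u' = u := by
  by_contra h'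
  exact h (by rw [frozenEmbed_apply, if_neg h'])

/-- A non-zero entry of `V_K` sits in the row `e u ∪ K`. [cite: BratteliRobinsonII1997, §5.2.1 (Fock space 𝔉(𝔥₁ ⊕ 𝔥₂); occupation-number basis)] -/
theorem eq_combine_of_frozenEmbed_ne_zero {u' : Finset ι'} {u : Finset ι}
    (h : frozenEmbed e K u' u ≠ 0) : u' = combine e u K := by
  obtain ⟨h1, h2⟩ := env_eq_of_frozenEmbed_ne_zero e K h
  rw [← combine_pre_env (e := e) u', h1, h2]

omit [Fintype ι] in
/-- `transSign e r X · transSign e r X = 1` (private sign bookkeeping). [folklore] -/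
private theorem transSign_mul_self (r : Finset ι') (X : Finset ι) : transSign e r X * transSign e r X = 1 := by
  rw [transSign_mul_transSign, symmDiff_self, Finset.bot_eq_empty, transSign_empty]

variable {K}

/-- The entry of `V_K` in the row `e u ∪ K` of column `u` is the sign `transSign e K u`. [cite: BratteliRobinsonII1997, §5.2.1 (Fock space 𝔉(𝔥₁ ⊕ 𝔥₂); occupation-number basis)] -/
theorem frozenEmbed_combine (hK : Disjoint K (rangeF e)) (u : Finset ι) :
    frozenEmbed e K (combine e u K) u = transSign e K u := by
  rw [frozenEmbed_apply, if_pos ⟨env_combine hK u, pre_combine hK u⟩]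

/-- **`V_K` on vectors**: `(V_K ψ)(u') = [env e u' = K] · transSign e K (pre e u') · ψ (pre e u')`.
[cite: BratteliRobinsonII1997, §5.2.1-5.2.2 (Fock space of a direct sum; Thm. 5.2.5)] -/
theorem frozenEmbed_mulVec_apply (ψ : Fock ι) (u' : Finset ι') :
    (frozenEmbed e K *ᵥ ψ) u' =
      if env e u' = K then transSign e K (pre e u') * ψ (pre e u') else 0 := by
  rw [mulVec, dotProduct]
  by_cases h : env e u' = K
  · rw [if_pos h, Finset.sum_eq_single (pre e u')]
    · rw [frozenEmbed_apply, if_pos ⟨h, rfl⟩]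
    · intro u _ hu
      rw [frozenEmbed_apply, if_neg (fun h' => hu h'.2.symm), zero_mul]
    · intro h'
      exact absurd (Finset.mem_univ _) h'
  · rw [if_neg h]
    exact Finset.sum_eq_zero fun u _ => by rw [frozenEmbed_apply_of_env_ne e K h, zero_mul]

/-- The size of a recombined configuration: `|e u ∪ r| = |u| + |r|` for an environment `r`. [cite: BratteliRobinsonII1997, §5.2.1 (Fock space 𝔉(𝔥₁ ⊕ 𝔥₂); occupation-number basis)] -/
theorem card_combine {r : Finset ι'} (hr : Disjoint r (rangeF e)) (u : Finset ι) :
    (combine e u r).card = u.card + r.card := by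
  rw [combine, Finset.card_union_of_disjoint, Finset.card_map]
  refine Finset.disjoint_left.2 fun j hj hjr => ?_
  obtain ⟨i, -, rfl⟩ := Finset.mem_map.1 hj
  exact Finset.disjoint_left.1 hr hjr (apply_mem_rangeF i)

/-- **Particle number**: `V_K` maps the `N`-particle sector into the `(N + |K|)`-particle sector.
[cite: KoridonEtAl2021, App. A eq. (A1)] -/
theorem isNParticle_frozenEmbed_mulVec (hK : Disjoint K (rangeF e)) {N : ℕ} {ψ : Fock ι}
    (hψ : IsNParticle N ψ) : IsNParticle (N + K.card) (frozenEmbed e K *ᵥ ψ) := by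
  intro u' hu'
  rw [frozenEmbed_mulVec_apply]
  split_ifs with h
  · by_cases hψ0 : ψ (pre e u') = 0
    · rw [hψ0, mul_zero]
    · exfalso
      apply hu'
      have hN : (pre e u').card = N := by
        by_contra hne
        exact hψ0 (hψ _ hne)
      rw [← combine_pre_env (e := e) u', h, card_combine e hK, hN]
  · rfl

end Def

section Algebra

variable {ι ι' : Type*} [LinearOrder ι] [LinearOrder ι'] [Fintype ι] [Fintype ι']
variable (e : ι ↪o ι') {K : Finset ι'}

/-- **`V_K` is an isometry**: `V_Kᴴ V_K = 1`. [cite: BratteliRobinsonII1997, §5.2.1-5.2.2 (Fock space of a direct sum; Thm. 5.2.5)] -/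
theorem conjTranspose_frozenEmbed_mul_self (hK : Disjoint K (rangeF e)) :
    (frozenEmbed e K)ᴴ * frozenEmbed e K = 1 := by
  ext u w
  rw [Matrix.mul_apply, Finset.sum_eq_single (combine e u K)]
  · rw [conjTranspose_apply, frozenEmbed_combine e hK, frozenEmbed_apply, env_combine hK,
      pre_combine hK, star_transSign, Matrix.one_apply]
    by_cases huw : u = w
    · subst huw
      rw [if_pos ⟨rfl, rfl⟩, if_pos rfl, transSign_mul_self]
    · rw [if_neg (fun h => huw h.2), mul_zero, if_neg huw]
  · intro u' _ hu'
    rw [conjTranspose_apply]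
    by_cases h0 : frozenEmbed e K u' u = 0
    · rw [h0, star_zero, zero_mul]
    · exact absurd (eq_combine_of_frozenEmbed_ne_zero e K h0) hu'
  · intro h
    exact absurd (Finset.mem_univ _) h

/-- `V_K` preserves inner products: `⟨V_K ψ, V_K χ⟩ = ⟨ψ, χ⟩`. [cite: BratteliRobinsonII1997, §5.2.1 (Fock space 𝔉(𝔥₁ ⊕ 𝔥₂); occupation-number basis)] -/
theorem star_frozenEmbed_mulVec_dotProduct (hK : Disjoint K (rangeF e)) (ψ χ : Fock ι) :
    star (frozenEmbed e K *ᵥ ψ) ⬝ᵥ (frozenEmbed e K *ᵥ χ) = star ψ ⬝ᵥ χ := by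
  rw [star_mulVec, ← dotProduct_mulVec, mulVec_mulVec, conjTranspose_frozenEmbed_mul_self e hK,
    one_mulVec]

/-- **`V_K` intertwines the second quantisation of `e`**: `jwEmbed e a · V_K = V_K · a` for every
operator `a` of `𝔉(ι)` (the frozen block is a copy of the defining representation of `𝔄(ι)`; the
sign `transSign` in `V_K` is forced by the environment signs of `jwEmbed`).
[cite: BratteliRobinsonII1997, §5.2.2, Thm. 5.2.5 (the Fock representation restricted to 𝔄(𝔥₁))] -/
theorem jwEmbed_mul_frozenEmbed (hK : Disjoint K (rangeF e)) (a : Matrix (Finset ι) (Finset ι) ℂ) :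
    jwEmbed e a * frozenEmbed e K = frozenEmbed e K * a := by
  ext u' u
  have hL : (jwEmbed e a * frozenEmbed e K) u' u =
      if env e u' = K then a (pre e u') u * transSign e K (pre e u') else 0 := by
    rw [Matrix.mul_apply, Finset.sum_eq_single (combine e u K)]
    · rw [jwEmbed_apply, embedFun_apply, env_combine hK, pre_combine hK, frozenEmbed_combine e hK]
      by_cases h : env e u' = K
      · rw [if_pos h, if_pos h, h, mul_assoc, transSign_mul_transSign, symmDiff_symmDiff_cancel_right]
      · rw [if_neg h, if_neg h, zero_mul]
    · intro w' _ hw'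
      by_cases h0 : frozenEmbed e K w' u = 0
      · rw [h0, mul_zero]
      · exact absurd (eq_combine_of_frozenEmbed_ne_zero e K h0) hw'
    · intro h
      exact absurd (Finset.mem_univ _) h
  have hR : (frozenEmbed e K * a) u' u =
      if env e u' = K then a (pre e u') u * transSign e K (pre e u') else 0 := by
    rw [Matrix.mul_apply, Finset.sum_eq_single (pre e u')]
    · rw [frozenEmbed_apply]
      by_cases h : env e u' = K
      · rw [if_pos ⟨h, rfl⟩, if_pos h, mul_comm]
      · rw [if_neg (fun h' => h h'.1), if_neg h, zero_mul]
    · intro w _ hw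
      rw [frozenEmbed_apply, if_neg (fun h' => hw h'.2.symm), zero_mul]
    · intro h
      exact absurd (Finset.mem_univ _) h
  rw [hL, hR]

/-- `c_{e i} V_K = V_K c_i`. [cite: BratteliRobinsonII1997, §5.2.2, eq. (5.2.13)] -/
theorem annihilation_apply_mul_frozenEmbed (hK : Disjoint K (rangeF e)) (i : ι) :
    annihilation (e i) * frozenEmbed e K = frozenEmbed e K * annihilation i := by
  rw [← jwEmbed_annihilation, jwEmbed_mul_frozenEmbed e hK]

/-- `c†_{e i} V_K = V_K c†_i`. [cite: BratteliRobinsonII1997, §5.2.2, eq. (5.2.13)] -/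
theorem creation_apply_mul_frozenEmbed (hK : Disjoint K (rangeF e)) (i : ι) :
    creation (e i) * frozenEmbed e K = frozenEmbed e K * creation i := by
  rw [← jwEmbed_creation, jwEmbed_mul_frozenEmbed e hK]

/-- `V_Kᴴ · jwEmbed e a = a · V_Kᴴ`. [cite: BratteliRobinsonII1997, §5.2.2, Thm. 5.2.5 (the Fock representation restricted to 𝔄(𝔥₁))] -/
theorem conjTranspose_frozenEmbed_mul_jwEmbed (hK : Disjoint K (rangeF e))
    (a : Matrix (Finset ι) (Finset ι) ℂ) :
    (frozenEmbed e K)ᴴ * jwEmbed e a = a * (frozenEmbed e K)ᴴ := by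
  have h := congr_arg conjTranspose (jwEmbed_mul_frozenEmbed e hK aᴴ)
  rw [conjTranspose_mul, conjTranspose_mul, ← jwEmbed_conjTranspose, conjTranspose_conjTranspose] at h
  exact h

/-- **The compression of an embedded observable is the observable**: `V_Kᴴ (jwEmbed e a) V_K = a`.
[cite: BratteliRobinsonII1997, §5.2.2, Thm. 5.2.5 (the Fock representation restricted to 𝔄(𝔥₁))] -/
theorem conjTranspose_frozenEmbed_mul_jwEmbed_mul_frozenEmbed (hK : Disjoint K (rangeF e))
    (a : Matrix (Finset ι) (Finset ι) ℂ) :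
    (frozenEmbed e K)ᴴ * jwEmbed e a * frozenEmbed e K = a := by
  rw [Matrix.mul_assoc, jwEmbed_mul_frozenEmbed e hK, ← Matrix.mul_assoc,
    conjTranspose_frozenEmbed_mul_self e hK, Matrix.one_mul]

/-! ### The environment letters on the frozen block -/

/-- A frozen environment orbital is occupied: `n_k V_K = V_K` for `k ∈ K`.
[cite: KoridonEtAl2021, App. A (frozen orbitals are always occupied)] -/
theorem numberAt_mul_frozenEmbed_of_mem {k : ι'} (hk : k ∈ K) :
    numberAt k * frozenEmbed e K = frozenEmbed e K := by
  ext u' u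
  rw [numberAt_eq_diagonal, Matrix.diagonal_mul]
  by_cases h0 : frozenEmbed e K u' u = 0
  · rw [h0, mul_zero]
  · obtain ⟨h1, -⟩ := env_eq_of_frozenEmbed_ne_zero e K h0
    have hku : k ∈ env e u' := h1.symm ▸ hk
    rw [if_pos (mem_env.1 hku).1, one_mul]

/-- `V_Kᴴ n_k = V_Kᴴ` for `k ∈ K`. [cite: KoridonEtAl2021, App. A eq. (A1) (frozen orbitals always occupied)] -/
theorem conjTranspose_frozenEmbed_mul_numberAt_of_mem {k : ι'} (hk : k ∈ K) :
    (frozenEmbed e K)ᴴ * numberAt k = (frozenEmbed e K)ᴴ := by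
  conv_rhs => rw [← numberAt_mul_frozenEmbed_of_mem e hk]
  rw [conjTranspose_mul, (numberAt_isHermitian k).eq]

/-- One cannot create into a frozen (occupied) environment orbital: `c†_k V_K = 0` for `k ∈ K`.
[cite: KoridonEtAl2021, App. A (frozen orbitals are always occupied)] -/
theorem creation_mul_frozenEmbed_eq_zero {k : ι'} (hk : k ∈ K) :
    creation k * frozenEmbed e K = 0 := by
  ext u' u
  rw [Matrix.mul_apply, Matrix.zero_apply]
  refine Finset.sum_eq_zero fun w' _ => ?_
  rw [creation_apply]
  split_ifs with h
  · obtain ⟨hkw', rfl⟩ := h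
    rw [frozenEmbed_apply, if_neg, mul_zero]
    rintro ⟨henv, -⟩
    exact hkw' (mem_env.1 (henv.symm ▸ hk : k ∈ env e w')).1
  · rw [zero_mul]

/-- An environment orbital outside `K` is empty: `c_m V_K = 0` for `m ∉ K` outside the image.
[cite: KoridonEtAl2021, App. A (virtual orbitals are always unoccupied)] -/
theorem annihilation_mul_frozenEmbed_eq_zero {m : ι'} (hm : m ∉ rangeF e) (hmK : m ∉ K) :
    annihilation m * frozenEmbed e K = 0 := by
  ext u' u
  rw [Matrix.mul_apply, Matrix.zero_apply]
  refine Finset.sum_eq_zero fun w' _ => ?_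
  rw [annihilation_apply]
  split_ifs with h
  · obtain ⟨-, rfl⟩ := h
    rw [frozenEmbed_apply, if_neg, mul_zero]
    rintro ⟨henv, -⟩
    exact hmK (henv ▸ mem_env.2 ⟨Finset.mem_insert_self _ _, hm⟩)
  · rw [zero_mul]

/-- `c_k c_k = 0` (private bookkeeping). [folklore] -/
private theorem annihilation_mul_annihilation_same (k : ι') :
    annihilation k * annihilation k = 0 := by
  have h := congr_arg conjTranspose (creation_mul_self k)
  rwa [conjTranspose_mul, creation_conjTranspose, conjTranspose_zero] at h

/-- A closed-shell environment carries no spin flip / no hopping: `c†_k c_m V_K = 0` for `k ∈ K` and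
`m ≠ k`. [cite: KoridonEtAl2021, App. A eq. (A1) (frozen orbitals always occupied)] -/
theorem creation_mul_annihilation_mul_frozenEmbed_eq_zero {k m : ι'} (hk : k ∈ K) (hkm : k ≠ m) :
    creation k * annihilation m * frozenEmbed e K = 0 := by
  have h : creation k * annihilation m = -(annihilation m * creation k) := by
    rw [annihilation_mul_creation, if_neg (Ne.symm hkm), zero_sub, neg_neg]
  rw [h, Matrix.neg_mul, Matrix.mul_assoc, creation_mul_frozenEmbed_eq_zero e hk, Matrix.mul_zero, neg_zero]

/-! ### Commutation with the environment number operators -/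

/-- `c†_k` commutes with `n_m` for `k ≠ m` (`[n_a, c†_b] = δ_ab c†_b`). [cite: EsslerEtAl2005, §2.1 eq. (2.8)] -/
theorem commute_creation_numberAt_of_ne {k m : ι'} (h : k ≠ m) : Commute (creation k) (numberAt m) :=
  (number_mul_creation_of_ne (Ne.symm h)).symm

/-- `c_k` commutes with `n_m` for `k ≠ m` (`[n_a, c_b] = -δ_ab c_b`). [cite: EsslerEtAl2005, §2.1 eq. (2.8)] -/
theorem commute_annihilation_numberAt_of_ne {k m : ι'} (h : k ≠ m) :
    Commute (annihilation k) (numberAt m) := by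
  have h1 := congr_arg conjTranspose (commute_creation_numberAt_of_ne h).eq
  rw [conjTranspose_mul, conjTranspose_mul, creation_conjTranspose, (numberAt_isHermitian m).eq] at h1
  exact h1.symm

/-- Embedded observables commute with the environment number operators: `[jwEmbed e a, n_m] = 0` for
`m` outside the image. [cite: BratteliRobinsonII1997, §5.2.2 (even elements of disjoint regions commute)] -/
theorem commute_jwEmbed_numberAt (a : Matrix (Finset ι) (Finset ι) ℂ) {m : ι'} (hm : m ∉ rangeF e) :
    Commute (jwEmbed e a) (numberAt m) := by
  rw [Commute, SemiconjBy, numberAt_eq_diagonal]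
  ext u' v'
  rw [Matrix.mul_diagonal, Matrix.diagonal_mul, jwEmbed_apply, embedFun_apply]
  by_cases h : env e u' = env e v'
  · have hiff : m ∈ u' ↔ m ∈ v' := by
      constructor
      · intro hu
        exact (mem_env.1 (h ▸ mem_env.2 ⟨hu, hm⟩ : m ∈ env e v')).1
      · intro hv
        exact (mem_env.1 (h.symm ▸ mem_env.2 ⟨hv, hm⟩ : m ∈ env e u')).1
    by_cases hv : m ∈ v'
    · rw [if_pos hv, if_pos (hiff.2 hv), mul_one, one_mul]
    · rw [if_neg hv, if_neg (fun hu => hv (hiff.1 hu)), mul_zero, zero_mul]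
  · rw [if_neg h, zero_mul, mul_zero]

/-! ### Compression rules -/

/-- **An unpaired environment annihilator compresses to zero**: for an environment orbital `m` and
any `X` commuting with `n_m`, `V_Kᴴ (X c_m) V_K = 0` (if `m ∈ K`: `V_Kᴴ X c_m V_K = V_Kᴴ n_m X c_m V_K =
V_Kᴴ X c†_m c_m c_m V_K = 0`; if `m ∉ K`: `c_m V_K = 0`).
[cite: KoridonEtAl2021, App. A eqs. (A2)-(A3) (projection onto |Φ_frozen Φ_active⟩)] -/
theorem sandwich_annihilation_eq_zero (hK : Disjoint K (rangeF e)) {m : ι'} (hm : m ∉ rangeF e)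
    {X : Matrix (Finset ι') (Finset ι') ℂ} (hX : Commute X (numberAt m)) :
    (frozenEmbed e K)ᴴ * (X * annihilation m) * frozenEmbed e K = 0 := by
  by_cases hmK : m ∈ K
  · have h2 : numberAt m * (X * annihilation m) = 0 := by
      rw [← Matrix.mul_assoc, ← hX.eq, Matrix.mul_assoc, numberAt, Matrix.mul_assoc,
        annihilation_mul_annihilation_same, Matrix.mul_zero, Matrix.mul_zero]
    rw [← conjTranspose_frozenEmbed_mul_numberAt_of_mem e hmK, Matrix.mul_assoc _ (numberAt m), h2,
      Matrix.mul_zero, Matrix.zero_mul]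
  · have hK' := hK
    rw [Matrix.mul_assoc, Matrix.mul_assoc, annihilation_mul_frozenEmbed_eq_zero e hm hmK,
      Matrix.mul_zero, Matrix.mul_zero]

/-- **An unpaired environment creator compresses to zero**: `V_Kᴴ (c†_m X) V_K = 0` for an
environment orbital `m` and any `X` commuting with `n_m`.
[cite: KoridonEtAl2021, App. A eqs. (A2)-(A3) (projection onto |Φ_frozen Φ_active⟩)] -/
theorem sandwich_creation_eq_zero (hK : Disjoint K (rangeF e)) {m : ι'} (hm : m ∉ rangeF e)
    {X : Matrix (Finset ι') (Finset ι') ℂ} (hX : Commute X (numberAt m)) :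
    (frozenEmbed e K)ᴴ * (creation m * X) * frozenEmbed e K = 0 := by
  have hX' : Commute Xᴴ (numberAt m) := by
    have h1 := congr_arg conjTranspose hX.eq
    rw [conjTranspose_mul, conjTranspose_mul, (numberAt_isHermitian m).eq] at h1
    exact h1.symm
  have h := congr_arg conjTranspose (sandwich_annihilation_eq_zero e hK hm hX')
  rw [conjTranspose_mul, conjTranspose_mul, conjTranspose_mul, conjTranspose_conjTranspose,
    annihilation_conjTranspose, conjTranspose_conjTranspose, conjTranspose_zero,
    ← Matrix.mul_assoc] at h
  exact h

/-- **The environment pair rule**: for environment orbitals `k, m` and `X` commuting with `n_m`,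
`V_Kᴴ (X c†_k c_m) V_K = [k = m ∈ K] · V_Kᴴ X V_K` (an environment density-matrix element is that of
the Slater determinant `|K⟩`).
[cite: HelgakerJorgensenOlsen2000, eq. (1.7.17) (D^k_PQ = δ_PQ k_P for an ON vector)] -/
theorem sandwich_creation_mul_annihilation (hK : Disjoint K (rangeF e)) {k m : ι'}
    (hk : k ∉ rangeF e) (hm : m ∉ rangeF e) {X : Matrix (Finset ι') (Finset ι') ℂ}
    (hX : Commute X (numberAt m)) :
    (frozenEmbed e K)ᴴ * (X * (creation k * annihilation m)) * frozenEmbed e K =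
      if k = m ∧ k ∈ K then (frozenEmbed e K)ᴴ * X * frozenEmbed e K else 0 := by
  by_cases hkm : k = m
  · subst hkm
    by_cases hkK : k ∈ K
    · rw [if_pos ⟨rfl, hkK⟩, Matrix.mul_assoc _ (X * _), Matrix.mul_assoc X, ← numberAt,
        numberAt_mul_frozenEmbed_of_mem e hkK, Matrix.mul_assoc]
    · rw [if_neg (fun h => hkK h.2), Matrix.mul_assoc _ (X * _), Matrix.mul_assoc X,
        Matrix.mul_assoc (creation k), annihilation_mul_frozenEmbed_eq_zero e hk hkK, Matrix.mul_zero,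
        Matrix.mul_zero, Matrix.mul_zero]
  · rw [if_neg (fun h => hkm h.1), ← Matrix.mul_assoc X]
    exact sandwich_annihilation_eq_zero e hK hm (hX.mul_left (commute_creation_numberAt_of_ne hkm))

end Algebra

end Literature.MathematicalPhysics.QuantumLattice

end
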